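import Mathlib
import Literature.Computability.Complexity.LindseyLemma

/-!
# The parity pairing of the harmonic profile

Stub `stub_paritySumLB` of line `Sketch`, crux `RazWigdersonMatching`.

For `u`-bit vectors `x y : Fin u → Bool` put `k(x,y) = #{i | xᵢ ∧ yᵢ}` and let
`H(x,y) = (-1)^{k(x,y)}` be the Sylvester–Hadamard sign
(`Literature.Computability.Complexity.ipSign`, `ipSign_eq_pow`). The harmonic profile
`T(x,y) = 1/(1 + k(x,y))` of the Raz–Wigderson argument pairs with `H` to

  `Σ_{x,y} H(x,y) / (k(x,y) + 1) = (3^{u+1} - 2^{u+1}) / (u + 1) ≥ 3^u / (u + 1)`.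

Proof (moments): `(-1)^k/(k+1) = ∫₀¹ (-1)^k t^k dt`, so the pairing is
`∫₀¹ Σ_{x,y} (-t)^{k(x,y)} dt`; the integrand factorises over the `u` coordinates,
`Σ_{x,y} s^{k(x,y)} = (Σ_{a,b ∈ {0,1}} s^{[a = b = 1]})^u = (3 + s)^u`, whence the pairing is
`∫₀¹ (3 - t)^u dt = ∫₂³ t^u dt = (3^{u+1} - 2^{u+1})/(u+1)`, and `3^{u+1} - 2^{u+1} ≥ 3^u`
because `2^u ≤ 3^u`. Cancellation is essential: the sum of absolute values is `4^u`.
-/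

set_option linter.dupNamespace false

noncomputable section

namespace Summit.ValiantsHypothesis.ValiantsHypothesis.Theorems.ShallowShadowsRazWigdersonMatching

open Finset MeasureTheory intervalIntegral
open Literature.Computability.Complexity

/-- Coordinatewise factorisation of the generating sum: `Σ_{x,y} s^{#{i | xᵢ ∧ yᵢ}} = (3 + s)^u`
(each coordinate contributes `Σ_{a,b ∈ {0,1}} s^{[a ∧ b]} = 3 + s`). -/
private theorem sum_sum_pow_card (u : ℕ) (s : ℝ) :
    ∑ x : Fin u → Bool, ∑ y : Fin u → Bool,
        s ^ (univ.filter fun i : Fin u => (x i && y i) = true).card = (3 + s) ^ u := by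
  have h1 : ∀ x y : Fin u → Bool,
      s ^ (univ.filter fun i : Fin u => (x i && y i) = true).card =
        ∏ i, (if (x i && y i) = true then s else (1 : ℝ)) := by
    intro x y
    rw [prod_ite, prod_const_one, mul_one, prod_const]
  have h2 : ∀ x : Fin u → Bool,
      ∑ y : Fin u → Bool, ∏ i, (if (x i && y i) = true then s else (1 : ℝ)) =
        ∏ i, ∑ b : Bool, (if (x i && b) = true then s else (1 : ℝ)) := fun x =>
    (Fintype.prod_sum fun (i : Fin u) (b : Bool) => if (x i && b) = true then s else (1 : ℝ)).symm
  have h3 : ∑ x : Fin u → Bool, ∏ i, ∑ b : Bool, (if (x i && b) = true then s else (1 : ℝ)) =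
      ∏ _i : Fin u, ∑ a : Bool, ∑ b : Bool, (if (a && b) = true then s else (1 : ℝ)) :=
    (Fintype.prod_sum fun (_ : Fin u) (a : Bool) =>
      ∑ b : Bool, if (a && b) = true then s else (1 : ℝ)).symm
  have h4 : ∑ a : Bool, ∑ b : Bool, (if (a && b) = true then s else (1 : ℝ)) = 3 + s := by
    rw [Fintype.sum_bool, Fintype.sum_bool, Fintype.sum_bool]
    simp only [Bool.and_self, Bool.and_false, Bool.and_true, Bool.false_eq_true, if_true,
      if_false]
    ring
  simp_rw [h1, h2]
  rw [h3, Fin.prod_const, h4]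

/-- The moments `∫₀¹ (-1)^n t^n dt = (-1)^n/(n+1)`. -/
private theorem neg_one_pow_div_eq_integral (n : ℕ) :
    (-1 : ℝ) ^ n / ((n : ℝ) + 1) = ∫ t in (0 : ℝ)..1, (-1 : ℝ) ^ n * t ^ n := by
  rw [intervalIntegral.integral_const_mul, integral_pow, one_pow, zero_pow (Nat.add_one_ne_zero n),
    sub_zero, mul_one_div]

/-- Swapping a finite double sum of (polynomial, hence continuous) moment integrands with the
interval integral. -/
private theorem sum_sum_integral_moment {α β : Type*} [Fintype α] [Fintype β]
    (k : α → β → ℕ) (c d : ℝ) :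
    ∑ a, ∑ b, ∫ t in c..d, (-1 : ℝ) ^ k a b * t ^ k a b =
      ∫ t in c..d, ∑ a, ∑ b, (-1 : ℝ) ^ k a b * t ^ k a b := by
  have hF : ∀ a b, Continuous fun t : ℝ => (-1 : ℝ) ^ k a b * t ^ k a b := fun a b => by
    fun_prop
  have h1 : ∀ a, ∑ b, ∫ t in c..d, (-1 : ℝ) ^ k a b * t ^ k a b =
      ∫ t in c..d, ∑ b, (-1 : ℝ) ^ k a b * t ^ k a b := fun a =>
    (intervalIntegral.integral_finsetSum fun b _ => (hF a b).intervalIntegrable c d).symm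
  have hG : ∀ a, Continuous fun t : ℝ => ∑ b, (-1 : ℝ) ^ k a b * t ^ k a b := fun a =>
    continuous_finsetSum _ fun b _ => hF a b
  simp_rw [h1]
  exact (intervalIntegral.integral_finsetSum fun a _ => (hG a).intervalIntegrable c d).symm

/-- `∫₀¹ (3 - t)^u dt = (3^{u+1} - 2^{u+1})/(u+1)`. -/
private theorem integral_three_sub_pow (u : ℕ) :
    ∫ t in (0 : ℝ)..1, (3 - t) ^ u = ((3 : ℝ) ^ (u + 1) - 2 ^ (u + 1)) / ((u : ℝ) + 1) := by
  rw [intervalIntegral.integral_comp_sub_left (fun t : ℝ => t ^ u) 3, integral_pow]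
  norm_num

/-- The exact value of the parity pairing of the harmonic profile:
`Σ_{x,y} H(x,y)/(k(x,y)+1) = (3^{u+1} - 2^{u+1})/(u+1)`. -/
private theorem paritySum_eq (u : ℕ) :
    ∑ x : Fin u → Bool, ∑ y : Fin u → Bool,
        ipSign x y / (((univ.filter fun i : Fin u => (x i && y i) = true).card : ℝ) + 1) =
      ((3 : ℝ) ^ (u + 1) - 2 ^ (u + 1)) / ((u : ℝ) + 1) := by
  simp_rw [ipSign_eq_pow, neg_one_pow_div_eq_integral]
  rw [sum_sum_integral_moment]
  have hfun : ∀ t : ℝ, ∑ x : Fin u → Bool, ∑ y : Fin u → Bool,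
      (-1 : ℝ) ^ (univ.filter fun i : Fin u => (x i && y i) = true).card *
        t ^ (univ.filter fun i : Fin u => (x i && y i) = true).card = (3 - t) ^ u := by
    intro t
    simp_rw [← neg_pow]
    rw [sub_eq_add_neg]
    exact sum_sum_pow_card u (-t)
  refine (intervalIntegral.integral_congr fun t _ => hfun t).trans ?_
  exact integral_three_sub_pow u

/-- **The parity pairing of the harmonic profile is large** (signature = `HarmonicParitySumLB`
verbatim): for the Sylvester–Hadamard sign `H(x,y) = (-1)^{#{i | xᵢ ∧ yᵢ}}` on pairs of `u`-bit
vectors, `3^u/(u+1) ≤ Σ_{x,y} H(x,y)/(#{i | xᵢ ∧ yᵢ} + 1)`; in fact the right-hand side equals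
`(3^{u+1} - 2^{u+1})/(u+1) = ∫₀¹ (3 - t)^u dt` (`paritySum_eq`). [folklore] -/
theorem stub_paritySumLB :
    ∀ u : ℕ, (3 : ℝ) ^ u / ((u : ℝ) + 1) ≤
      ∑ x : Fin u → Bool, ∑ y : Fin u → Bool,
        ipSign x y / (((Finset.univ.filter fun i : Fin u => (x i && y i) = true).card : ℝ) + 1) := by
  intro u
  rw [paritySum_eq u]
  refine div_le_div_of_nonneg_right ?_ (by positivity)
  have h : (2 : ℝ) ^ u ≤ 3 ^ u := pow_le_pow_left₀ (by norm_num) (by norm_num) u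
  rw [pow_succ, pow_succ]
  linarith

end Summit.ValiantsHypothesis.ValiantsHypothesis.Theorems.ShallowShadowsRazWigdersonMatching

end
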